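import Summits.Ventures.GridStability.Lyapunov.StructurePreservingPolytopeRate
import Summits.Ventures.GridStability.Lyapunov.StructurePreservingPolytopeRoa
import Summits.Ventures.GridStability.Lyapunov.StructurePreservingRateDiam
import HarnessLib

/-!
# GridStability/Lyapunov/StructurePreservingPolytopeRateRoa — «SP-RATE-POLYTOPE», part 2 (along solutions):
# the energy of MODEL MV-3 decays exponentially on the ★ #91 POLYTOPE region `{V ≤ c} ∩ 𝒫 ∩ leaf`,
# `c < min_e b_e·vtGap(σ*_e)`, at a rate certified by per-edge endpoint data

Cell `gridfusion` (LADDER-GRIDFUSION), seat gridfusion-lyap-1 (g8). Part 1 (`StructurePreservingPolytopeRate.lean`)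
proves the pointwise inequality `V̇_h ≤ −ρV_h` on the closed polytope sublevel from an `EdgeRateCert` and a
leaf-Poincaré pair `(A, B)`. HERE it is integrated along solutions: the ★ #91 region is positively invariant
(`vtSublevel_subset_regionOfAttraction`, p533955; [cite: VuTuritsyn2016, §IV]), so the closed polytope, the
leaf and `V ≤ c` hold along every solution from it; Khalil's comparison step (lit-6's
`Literature.Analysis.ODE.comp_le_mul_exp_neg_of_solution₀`, [cite: Khalil2002, Theorem 4.10]) gives
`V_h(X t) ≤ V_h(X 0)e^{−ρt}`; `V ≤ 3V_h` on the closed polytope (p545614) and `V_h ≤ C·V` at the start.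

* **`phaseEnergy_le_mul_exp_neg_vt`** — DATA: well-formed `p` on `n ≠ 0` buses, `b ≥ 0`, preconnected
  coupling graph, a synchronous equilibrium `δ₀` with coupled `|σ*| < π/2`, a level `c < bᵢⱼ·vtGap(σ*ᵢⱼ)` on
  coupled pairs, a certificate `EdgeRateCert p δ₀ c m k ℓ u` (`0 < m`), `0 < h` with `2hMᵢ ≤ Dᵢ` on the
  generators, a leaf-Poincaré pair `Σ Dᵢφᵢ² ≤ A·Q + B·K` on the leaf (`0 ≤ A`), `ρ ≥ 0` with
  `ρ(2 + hB) ≤ 2h`, `ρ(1 + hA/m) ≤ hk`, `C` with `2 + hB ≤ C`, `1 + hA/m ≤ C`. CLAIM: along EVERY global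
  solution `X` of the phase field from `S = {V ≤ c} ∩ 𝒫 ∩ leaf`, for all `t ≥ 0`,
  `V(X t) ≤ 3C·V(X 0)·exp(−ρt)`;
* `phaseEnergy_le_mul_exp_neg_vt_diam` — the same with the CLOSED-FORM diameter pair of p550229
  (`A = 4d·ΣD/β`, `B = 2Σ_gen M/ΣD`, `bᵢⱼ ≥ β > 0` on edges, walks of length `≤ d` between all nodes);
* `energy_le_mul_exp_neg_of_isSolution_vt` — the printed second-order vocabulary (frame rotating at `ω₀`).

Compared with the window rows (p545614/p550019): the REGION is the larger polytope well of ★ #91 (level up to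
`min_e b_e·vtGap(σ*_e)` instead of `c⋆(θ, β)`), and the uniform window gain `g(θ)` is replaced by the
certificate's `(m, k)`; the kinetic branch `2h/(2 + hB)` is unchanged. THREE COLUMNS: mathematics about
MODEL MV-3 (with `gen = univ`: MV-2L); `ρ` is a certified LOWER bound on the model's rate inside `S`; no
sentence here says a grid is stable or well damped. No definition, no named fact; standard axioms.
-/

noncomputable section

open Set Filter Topology Real Finset
open Summit.Ventures.GridStability.Models.StructurePreserving
open Summit.Ventures.GridStability.Models.StructurePreserving.Params
open Literature.MathematicalPhysics.PowerSystems.ClassicalModel.LosslessSystem (vtGap)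

namespace Summit.Ventures.GridStability.Lyapunov.StructurePreserving

variable {n : ℕ}

/-- **Exponential decay of the energy on the polytope region, certified by endpoint data** (the
«SP-RATE-POLYTOPE» sentence; DATA and CLAIM in the module docstring). Proof: invariance of
`S = {V ≤ c} ∩ 𝒫 ∩ leaf` (p533955), the pointwise rate `fderiv_vh_le_neg_mul_vt` along the solution,
lit-6's comparison step, `V ≤ 3V_h` on the closed polytope and `V_h ≤ C·V` at `t = 0`. MODEL MV-3; no
sentence here says a grid is stable or well damped. [cite: Khalil2002, Theorem 4.10] -/
theorem phaseEnergy_le_mul_exp_neg_vt {p : Params n} (hp : p.WellFormed) (hn : n ≠ 0)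
    (hconn : p.couplingGraph.Preconnected) (hb : ∀ i j, 0 ≤ p.b i j)
    {δ₀ : Fin n → ℝ} (h0 : ∀ i j, p.b i j ≠ 0 → |δ₀ i - δ₀ j| < π / 2) (hδ₀ : p.IsSyncEquilibrium δ₀)
    {c : ℝ} (hcgap : ∀ i j, p.b i j ≠ 0 → c < p.b i j * vtGap (δ₀ i - δ₀ j))
    {m k : ℝ} {ℓ u : Fin n → Fin n → ℝ} (hc : EdgeRateCert p δ₀ c m k ℓ u) (hm : 0 < m)
    {h : ℝ} (hh : 0 < h) (hhM : ∀ i ∈ p.gen, 2 * h * p.M i ≤ p.D i)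
    {A B : ℝ} (hA : 0 ≤ A)
    (hPoinc : ∀ x : (Fin n → ℝ) × (Fin n → ℝ), x ∈ constraintSet p δ₀ →
      ∑ i, p.D i * (x.1 i - δ₀ i) ^ 2
        ≤ A * ((1 / 2) * ∑ i, ∑ j, p.b i j * (((x.1 i - x.1 j) - (δ₀ i - δ₀ j)) ^ 2 / 2))
          + B * p.kinetic x.2)
    {ρ : ℝ} (hρ0 : 0 ≤ ρ) (hρK : ρ * (2 + h * B) ≤ 2 * h) (hρW : ρ * (1 + h * A / m) ≤ h * k)
    {C : ℝ} (hCK : 2 + h * B ≤ C) (hCW : 1 + h * A / m ≤ C)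
    {X : ℝ → (Fin n → ℝ) × (Fin n → ℝ)}
    (hX0 : X 0 ∈ vtPolytope p δ₀ ∩ constraintSet p δ₀ ∧ phaseEnergy p δ₀ (X 0) ≤ c)
    (hX : ∀ T : ℝ, ∀ t ∈ Icc 0 T, HasDerivWithinAt X (phaseField p (X t)) (Icc 0 T) t)
    {t : ℝ} (ht : 0 ≤ t) :
    phaseEnergy p δ₀ (X t) ≤ 3 * C * phaseEnergy p δ₀ (X 0) * Real.exp (-ρ * t) := by
  obtain ⟨-, hall⟩ := vtSublevel_subset_regionOfAttraction hp hn hconn hb h0 hδ₀ hcgap hX0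
  obtain ⟨hstay, -⟩ := hall X rfl hX
  have h0' : ∀ i j, p.b i j ≠ 0 → |δ₀ i - δ₀ j| ≤ π / 2 := fun i j hij => (h0 i j hij).le
  -- `V_h` decays at rate `ρ` along `X`
  have hcd : ContDiff ℝ 1 (fun y : (Fin n → ℝ) × (Fin n → ℝ) =>
      phaseEnergy p δ₀ y + h * crossTerm p δ₀ y) :=
    (contDiff_phaseEnergy p δ₀).add (contDiff_const.mul (contDiff_crossTerm p δ₀))
  have hVd : ∀ s ∈ Icc 0 t, HasFDerivAt (fun y : (Fin n → ℝ) × (Fin n → ℝ) =>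
      phaseEnergy p δ₀ y + h * crossTerm p δ₀ y)
      (fderiv ℝ (fun y : (Fin n → ℝ) × (Fin n → ℝ) => phaseEnergy p δ₀ y + h * crossTerm p δ₀ y)
        (X s)) (X s) :=
    fun s _ => ((hcd.differentiable one_ne_zero) (X s)).hasFDerivAt
  have hle : ∀ s ∈ Icc 0 t,
      fderiv ℝ (fun y : (Fin n → ℝ) × (Fin n → ℝ) => phaseEnergy p δ₀ y + h * crossTerm p δ₀ y)
          (X s) (phaseField p (X s))
        ≤ -ρ * (phaseEnergy p δ₀ (X s) + h * crossTerm p δ₀ (X s)) := by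
    intro s hs
    have hmem := hstay s hs.1
    have hP : ∀ i j, p.b i j ≠ 0 → |((X s).1 i - (X s).1 j) + (δ₀ i - δ₀ j)| ≤ π :=
      fun i j hij => (hmem.1.1 i j hij).le
    exact fderiv_vh_le_neg_mul_vt hp hb h0' hδ₀ hc hm hh hhM hP hmem.2 hA (hPoinc (X s) hmem.1.2)
      hρ0 hρK hρW
  have hdec := Literature.Analysis.ODE.comp_le_mul_exp_neg_of_solution₀ (hX t) hVd hle ⟨ht, le_rfl⟩
  -- `V ≤ 3V_h` at `X t`, `V_h ≤ C·V` at `X 0`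
  have hmem := hstay t ht
  have hPt : ∀ i j, p.b i j ≠ 0 → |((X t).1 i - (X t).1 j) + (δ₀ i - δ₀ j)| ≤ π :=
    fun i j hij => (hmem.1.1 i j hij).le
  have h3 := phaseEnergy_le_three_mul_vh hp hb h0' hh.le hhM hPt
  have hP0 : ∀ i j, p.b i j ≠ 0 → |((X 0).1 i - (X 0).1 j) + (δ₀ i - δ₀ j)| ≤ π :=
    fun i j hij => (hX0.1.1 i j hij).le
  have hgain := vh_le_mul_phaseEnergy_vt hp hb h0' hc hm hh.le hhM hP0 hX0.2 hA (hPoinc (X 0) hX0.1.2)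
    hCK hCW
  have hexp : 0 ≤ Real.exp (-ρ * t) := (Real.exp_pos _).le
  calc phaseEnergy p δ₀ (X t)
      ≤ 3 * (phaseEnergy p δ₀ (X t) + h * crossTerm p δ₀ (X t)) := h3
    _ ≤ 3 * ((phaseEnergy p δ₀ (X 0) + h * crossTerm p δ₀ (X 0)) * Real.exp (-ρ * t)) := by linarith
    _ ≤ 3 * ((C * phaseEnergy p δ₀ (X 0)) * Real.exp (-ρ * t)) := by
        have := mul_le_mul_of_nonneg_right hgain hexp
        linarith
    _ = 3 * C * phaseEnergy p δ₀ (X 0) * Real.exp (-ρ * t) := by ring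

/-- **The same sentence with the closed-form diameter pair** `A = 4d·ΣD/β`, `B = 2Σ_gen M/ΣD` of
p550229 (`sum_D_sq_le_of_diam`: `bᵢⱼ ≥ β > 0` on the edges, every two nodes joined by a walk of the
coupling graph of length `≤ d`). Along every global solution from the ★ #91 region, for all `t ≥ 0`:
`V(X t) ≤ 3C·V(X 0)·exp(−ρt)` whenever `ρ ≥ 0`, `ρ(2 + hB) ≤ 2h`, `ρ(1 + hA/m) ≤ hk`, `2 + hB ≤ C`,
`1 + hA/m ≤ C`. MODEL MV-3; no sentence here says a grid is stable or well damped.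
[cite: Khalil2002, Theorem 4.10] -/
theorem phaseEnergy_le_mul_exp_neg_vt_diam {p : Params n} (hp : p.WellFormed) (hn : n ≠ 0)
    (hb : ∀ i j, 0 ≤ p.b i j) {β : ℝ} (hβ : 0 < β)
    (hβb : ∀ i j, p.couplingGraph.Adj i j → β ≤ p.b i j) {d : ℕ}
    (hdiam : ∀ i j : Fin n, ∃ w : p.couplingGraph.Walk i j, w.length ≤ d)
    {δ₀ : Fin n → ℝ} (h0 : ∀ i j, p.b i j ≠ 0 → |δ₀ i - δ₀ j| < π / 2) (hδ₀ : p.IsSyncEquilibrium δ₀)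
    {c : ℝ} (hcgap : ∀ i j, p.b i j ≠ 0 → c < p.b i j * vtGap (δ₀ i - δ₀ j))
    {m k : ℝ} {ℓ u : Fin n → Fin n → ℝ} (hc : EdgeRateCert p δ₀ c m k ℓ u) (hm : 0 < m)
    {h : ℝ} (hh : 0 < h) (hhM : ∀ i ∈ p.gen, 2 * h * p.M i ≤ p.D i)
    {ρ : ℝ} (hρ0 : 0 ≤ ρ)
    (hρK : ρ * (2 + h * (2 * (∑ i ∈ p.gen, p.M i) / (∑ i, p.D i))) ≤ 2 * h)
    (hρW : ρ * (1 + h * (4 * (d : ℝ) * (∑ i, p.D i) / β) / m) ≤ h * k)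
    {C : ℝ} (hCK : 2 + h * (2 * (∑ i ∈ p.gen, p.M i) / (∑ i, p.D i)) ≤ C)
    (hCW : 1 + h * (4 * (d : ℝ) * (∑ i, p.D i) / β) / m ≤ C)
    {X : ℝ → (Fin n → ℝ) × (Fin n → ℝ)}
    (hX0 : X 0 ∈ vtPolytope p δ₀ ∩ constraintSet p δ₀ ∧ phaseEnergy p δ₀ (X 0) ≤ c)
    (hX : ∀ T : ℝ, ∀ t ∈ Icc 0 T, HasDerivWithinAt X (phaseField p (X t)) (Icc 0 T) t)
    {t : ℝ} (ht : 0 ≤ t) :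
    phaseEnergy p δ₀ (X t) ≤ 3 * C * phaseEnergy p δ₀ (X 0) * Real.exp (-ρ * t) := by
  have hconn : p.couplingGraph.Preconnected := fun i j => by
    obtain ⟨w, -⟩ := hdiam i j
    exact ⟨w⟩
  have hSD : 0 < ∑ i, p.D i := sum_D_pos hp hn
  have hA : 0 ≤ 4 * (d : ℝ) * (∑ i, p.D i) / β := by positivity
  exact phaseEnergy_le_mul_exp_neg_vt hp hn hconn hb h0 hδ₀ hcgap hc hm hh hhM hA
    (fun x hx => sum_D_sq_le_of_diam hp hn hb hβ hβb hdiam hx) hρ0 hρK hρW hCK hCW hX0 hX ht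

/-! ### Back to the printed second-order form -/

/-- **The «SP-RATE-POLYTOPE» sentence in the printed vocabulary (frame rotating at `ω₀`).** Under the data
of `phaseEnergy_le_mul_exp_neg_vt`, every solution `δ` of the shifted structure-preserving model in model-2's
second-order sense (`p.shifted.IsSolution δ`) whose initial state has every coupled line angle in the
polytope `|(δᵢ(0) − δⱼ(0)) + (δ₀ᵢ − δ₀ⱼ)| < π`, momentum `L(δ(0), δ̇(0)) = L(δ₀, 0)` and energy
`V(δ(0), δ̇(0)) ≤ c` satisfies, for all `t ≥ 0`, `V(δ(t), δ̇(t)) ≤ 3C·V(δ(0), δ̇(0))·exp(−ρt)`. MODEL MV-3;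
no sentence here says a grid is stable or well damped.
[cite: Padiyar2013, §3.2 eqs (3.2)–(3.5), (3.11)]; [cite: Khalil2002, Theorem 4.10] -/
theorem energy_le_mul_exp_neg_of_isSolution_vt {p : Params n} (hp : p.WellFormed) (hn : n ≠ 0)
    (hconn : p.couplingGraph.Preconnected) (hb : ∀ i j, 0 ≤ p.b i j)
    {δ₀ : Fin n → ℝ} (h0 : ∀ i j, p.b i j ≠ 0 → |δ₀ i - δ₀ j| < π / 2) (hδ₀ : p.IsSyncEquilibrium δ₀)
    {c : ℝ} (hcgap : ∀ i j, p.b i j ≠ 0 → c < p.b i j * vtGap (δ₀ i - δ₀ j))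
    {m k : ℝ} {ℓ u : Fin n → Fin n → ℝ} (hc : EdgeRateCert p δ₀ c m k ℓ u) (hm : 0 < m)
    {h : ℝ} (hh : 0 < h) (hhM : ∀ i ∈ p.gen, 2 * h * p.M i ≤ p.D i)
    {A B : ℝ} (hA : 0 ≤ A)
    (hPoinc : ∀ x : (Fin n → ℝ) × (Fin n → ℝ), x ∈ constraintSet p δ₀ →
      ∑ i, p.D i * (x.1 i - δ₀ i) ^ 2
        ≤ A * ((1 / 2) * ∑ i, ∑ j, p.b i j * (((x.1 i - x.1 j) - (δ₀ i - δ₀ j)) ^ 2 / 2))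
          + B * p.kinetic x.2)
    {ρ : ℝ} (hρ0 : 0 ≤ ρ) (hρK : ρ * (2 + h * B) ≤ 2 * h) (hρW : ρ * (1 + h * A / m) ≤ h * k)
    {C : ℝ} (hCK : 2 + h * B ≤ C) (hCW : 1 + h * A / m ≤ C)
    {δ : ℝ → Fin n → ℝ} (hδ : p.shifted.IsSolution δ)
    (hpol : ∀ i j, p.b i j ≠ 0 → |(δ 0 i - δ 0 j) + (δ₀ i - δ₀ j)| < π)
    (hL : p.momentum (δ 0) (fun i => deriv (fun u => δ u i) 0) = p.momentum δ₀ 0)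
    (hV : p.energy δ₀ (δ 0) (fun i => deriv (fun u => δ u i) 0) ≤ c) {t : ℝ} (ht : 0 ≤ t) :
    p.energy δ₀ (δ t) (fun i => deriv (fun u => δ u i) t)
      ≤ 3 * C * p.energy δ₀ (δ 0) (fun i => deriv (fun u => δ u i) 0) * Real.exp (-ρ * t) := by
  set X : ℝ → (Fin n → ℝ) × (Fin n → ℝ) :=
    fun s => (δ s, fun i => if i ∈ p.gen then deriv (fun u => δ u i) s else 0) with hXdef
  have hgen : ∀ s, ∀ i ∈ p.gen, (X s).2 i = deriv (fun u => δ u i) s := fun s i hi => by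
    simp [hXdef, hi]
  have hXsol : ∀ T : ℝ, ∀ t ∈ Icc 0 T, HasDerivWithinAt X (phaseField p (X t)) (Icc 0 T) t :=
    fun T t _ => (hasDerivAt_phase_of_isSolution hp hδ t).hasDerivWithinAt
  have hy : X 0 ∈ vtPolytope p δ₀ ∩ constraintSet p δ₀ ∧ phaseEnergy p δ₀ (X 0) ≤ c := by
    refine ⟨⟨hpol, ?_, fun i hi => by simp [hXdef, hi]⟩, ?_⟩
    · rw [momentum_congr_gen p (δ 0) (hgen 0)]
      exact hL
    · rw [phaseEnergy_apply, energy_congr_gen p δ₀ (δ 0) (hgen 0)]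
      exact hV
  have hmain := phaseEnergy_le_mul_exp_neg_vt hp hn hconn hb h0 hδ₀ hcgap hc hm hh hhM hA hPoinc hρ0
    hρK hρW hCK hCW hy hXsol ht
  rw [phaseEnergy_apply, phaseEnergy_apply, energy_congr_gen p δ₀ (δ t) (hgen t),
    energy_congr_gen p δ₀ (δ 0) (hgen 0)] at hmain
  exact hmain

end Summit.Ventures.GridStability.Lyapunov.StructurePreserving

end
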